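import Mathlib

/-!
# `MatrixDescartes` census — PIVOT-PENCIL vocabulary (the index-graded column of the Conjecture-B programme)

HONEST FRAMING.  Definitions-only companion (plus three bookkeeping nesting lemmas; nothing asserted) of the
object-search cell `pub-symmetroid`'s CONJECTURE-B programme (`KPlusLogSqLaw`, `…CensusDefs.lean`), seat `conjb-1`
(ideation seat 1 of 3, generations g0–g2, 2026-08-25; author of every definition below, HOME files
`pub-symmetroid-conjb-1/ConjB1Sketch.lean`, `ConjB1SketchR2.lean`, `g2/lean/ConjB1SketchR3.lean`, all farm rc 0), typed
for the tree by the cell's typer (g8) at the desk's request (lead R1312/R1313/R1317/R1320: «ONE shared PivotDefs definition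
file first, then the index-1 column next to it»).  Route crux of record: `Theses.LacunarySymmetroid.MatrixDescartes`
(ledger item stmt-ValiantsHypothesis-18050); this file is landed as a HELPER of that item with NO closure claim and says
nothing about `KPlusLogSqLaw`, `MatrixDescartes` or `VP ≠ VNP`.

THE OBJECT.  A PIVOT PENCIL of format `(m, K)` is `F(X) = X^e • J + ∑ₖ X^{d k} • P k` with `J` a real symmetric
`m × m` matrix (the pivot letter, exponent `e`) and `K` positive-semidefinite letters `P k` at exponents `d k`; its
PIVOT INDEX is `≤ q` when `J + W Wᵀ ⪰ 0` for some real `m × q` matrix `W` (i.e. `J` has at most `q` negative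
eigenvalues).  This is the cell's «OneIndefinite» normal form graded by the index (`…LiftNormalForm.lean`,
`…FirstRung.lean`: by Weyl, `F(x) ⪰ −x^e W Wᵀ` for `x > 0`, so the inertia walk of `F` is confined to `{0,…,q}`).
`pivotPosRoots e d J P` is the census currency `Z₊` = number of distinct positive zeros of `det F`
(`(…).roots.toFinset.filter (0 < ·)).card`, the zero polynomial counting none), and `PivotRootLawAt m K q B` is the row
«every pivot pencil of format `(m,K)` and index `≤ q` has `Z₊ ≤ B`».

THE COLUMN OF RECORD (status 2026-08-26, annotated 2026-08-27; companion files `…CensusPivot*.lean` carry the proofs / certificates):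
* R0  `OneSidedIndexRung`        — one-sided exponents ⇒ `Z₊ ≤ q`.                    PROVED (conjb-1 g0; `…PivotIndexRung`).
* R1  `RankOnePivotLaw`          — index 1 ⇒ `Z₊ ≤ 2m`, K-free.                      REFUTED (g0: a `2 × 2`, `K = 4` object with 5 roots).
* R1₂ `RankOnePivotLawTwo`       — `m = 2`, index 1 ⇒ `Z₊ ≤ 2K + 2`.                 PROVED (g0, Descartes + mixed discriminants; any index).
*     `RankOneStaircase`         — `m = 2`, index 1: `Z₊ ≥ 2K − 3` for all `K ≥ 4`.    OPEN as a family; members `K = 4, 5, 6`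
                                                                                       certified exactly (5, 7, 9 roots).
* R1″ `RankOnePivotLawLinK`      — index 1 ⇒ `Z₊ ≤ 2m(K+1)`.                          OPEN (g2).
* R1‴ `RankOnePivotLawBilinear`  — index 1 ⇒ `Z₊ ≤ 2(m−1)(K−1) + 2` (dent census).    OPEN (g2; one-seat numerical pattern).
* R1‴b `RankOnePivotLawBilinearWeak` — index 1 ⇒ `Z₊ ≤ 2(m−1)K + 2`.                  OPEN (g2; = R1₂ at `m = 2`).
*     `DiagonalRankOneLaw`       — diagonal PSD letters, index 1 ⇒ `Z₊ ≤ m²(K+1) + 2`.  OPEN (g2).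
*     `RankOneResolventDescartes` — index 1 ⇒ `Z₊ ≤ 2·C(K+m−1, m−1)`, all `m, K`. PROVED (val-sym-mdr-p2 g3, p447079:
                                                                                       `Pivot.rankOneResolventDescartes_holds`,
                                                                                       `…CensusPivotResolventDescartes`; desk R1484 (a)).
* law-level shapes `RankOnePivotLawLin` (R1⁻), `RankOnePivotLawPoly` (R1′),
  `PivotIndexLaw` (PIL), `PivotIndexLawK` (PIL_K), `PivotIndexLawPoly` (PIL′ = C1′)                     OPEN.
Located lower-bound data of record (kernel certificates in the companions): index-1 objects with 5 / 7 / 9 positive roots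
at `(m,K) = (2,4) / (2,5) / (2,6)` («softmax staircase») and TIME-MULTIPLEXED staircases with 11 / 15 roots at
`(4,4) / (4,5)` (pattern `(K−1)·m − 1`), so every K-free or `a·m + b·K` shape at index 1 is dead (STRUCTURE.md §4).

Design choices: sizes and letter counts are `Fin m` / `Fin K` as in `…CensusDefs.RealRootLawAt`; the index is carried by
the WIDTH `q` of `W` (no eigenvalue count, no `sInf`); budgets `B` are free naturals (rows are inequalities, refuted rows
are `¬ PivotRootLawAt …`), so no junk values occur; natural-number subtraction appears only in the printed shapes
`2K − 4`, `2(m−1)(K−1)+2`, documented where used.  Deliberately NOT here: the measure-theoretic slope-resonance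
statements and the alternating tower of conjb-1 g2's memo §1–§2 (they need their own vocabulary), the G-normal-form
coupling laws of g0 (a different currency), and any theorem beyond bookkeeping.
-/

-- `Summit.ValiantsHypothesis.ValiantsHypothesis.…` repeats a component by the D-0017 layout
-- (single-conjunct summit), which the `dupNamespace` linter flags; the name is mandated.
set_option linter.dupNamespace false

namespace Summit.ValiantsHypothesis.ValiantsHypothesis.Theorems.LacunarySymmetroidMatrixDescartes.Pivot

open Polynomial Matrix Finset
open scoped BigOperators

/-! ## The objects -/

/-- **`Z₊` of a pivot pencil.**  `pivotPosRoots e d J P` = the number of distinct positive real zeros of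
`det (X^e • J + ∑ₖ X^{d k} • P k)` for an `m × m` pivot letter `J` at exponent `e` and `K` letters `P k` at
exponents `d k` (census currency: `roots.toFinset` filtered by `0 < ·`; the zero polynomial has no roots).
[definition of the cell (conjb-1 g0, `ConjB1Sketch.lean`); no citation exists] -/
noncomputable def pivotPosRoots {m K : ℕ} (e : ℕ) (d : Fin K → ℕ) (J : Matrix (Fin m) (Fin m) ℝ)
    (P : Fin K → Matrix (Fin m) (Fin m) ℝ) : ℕ :=
  ((Matrix.det (((X : ℝ[X]) ^ e) • J.map Polynomial.C
      + ∑ k, ((X : ℝ[X]) ^ d k) • (P k).map Polynomial.C)).roots.toFinset.filter (fun t => 0 < t)).card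

/-- **Pivot root law at format `(m, K)`, pivot index `≤ q`, budget `B`.**  Every pivot pencil
`X^e • J + ∑ₖ X^{d k} • P k` with `J` real symmetric, all `P k ⪰ 0`, and `J + W Wᵀ ⪰ 0` for SOME real `m × q`
matrix `W` (negative index of `J` at most `q`) has at most `B` distinct positive determinant zeros.
[definition of the cell (conjb-1 g0, `ConjB1Sketch.lean`); no citation exists] -/
def PivotRootLawAt (m K q B : ℕ) : Prop :=
  ∀ (e : ℕ) (d : Fin K → ℕ) (J : Matrix (Fin m) (Fin m) ℝ) (P : Fin K → Matrix (Fin m) (Fin m) ℝ),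
    J.IsSymm → (∀ k, (P k).PosSemidef) →
    (∃ W : Matrix (Fin m) (Fin q) ℝ, (J + W * Wᵀ).PosSemidef) →
    pivotPosRoots e d J P ≤ B

/-- **One-sided pivot root law** — the same row restricted to pencils whose PSD exponents all lie on ONE side of the
pivot exponent (`∀ k, e ≤ d k` or `∀ k, d k ≤ e`).
[definition of the cell (conjb-1 g0, `ConjB1Sketch.lean`); no citation exists] -/
def OneSidedPivotRootLawAt (m K q B : ℕ) : Prop :=
  ∀ (e : ℕ) (d : Fin K → ℕ) (J : Matrix (Fin m) (Fin m) ℝ) (P : Fin K → Matrix (Fin m) (Fin m) ℝ),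
    J.IsSymm → (∀ k, (P k).PosSemidef) →
    (∃ W : Matrix (Fin m) (Fin q) ℝ, (J + W * Wᵀ).PosSemidef) →
    ((∀ k, e ≤ d k) ∨ (∀ k, d k ≤ e)) →
    pivotPosRoots e d J P ≤ B

/-- Rows are monotone in the budget: `PivotRootLawAt m K q B → B ≤ B' → PivotRootLawAt m K q B'`. [bookkeeping] -/
theorem pivotRootLawAt_mono {m K q B B' : ℕ} (h : PivotRootLawAt m K q B) (hB : B ≤ B') :
    PivotRootLawAt m K q B' :=
  fun e d J P hJ hP hW => (h e d J P hJ hP hW).trans hB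

/-- The one-sided row is implied by the unrestricted row with the same parameters. [bookkeeping] -/
theorem oneSidedPivotRootLawAt_of_pivotRootLawAt {m K q B : ℕ} (h : PivotRootLawAt m K q B) :
    OneSidedPivotRootLawAt m K q B :=
  fun e d J P hJ hP hW _ => h e d J P hJ hP hW

/-! ## The laws of the column (named `Prop`s; NEVER asserted here) -/

/-- **R0 — one-sided index rung**: for one-sided pivot pencils `Z₊ ≤ q` = the pivot index, uniformly in `m`, `K` and
the exponents (sharpens the tree's `firstRung_oneSided`, `Z₊ ≤ m`).  STATUS: PROVED by conjb-1 g0 (downward inertia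
chain + kernel dimension count; companion file `…CensusPivotIndexRung.lean`).
[statement of the cell (conjb-1 g0); no citation exists] -/
def OneSidedIndexRung : Prop := ∀ m K q : ℕ, OneSidedPivotRootLawAt m K q q

/-- **R1 — RANK-ONE PIVOT LAW** (conjb-1 g0's first killable family rung): pivot index `1 ⇒ Z₊ ≤ 2m`, uniformly in
`K` and in the exponents.  STATUS: REFUTED by conjb-1 g0 — an exact `2 × 2` index-1 pencil with `K = 4` diagonal PSD
letters (exponents `5, 16, 0, 6`, pivot exponent `4`) has `5 > 4` positive roots («softmax staircase»; companion file
`…CensusPivotRankOne.lean`, `not_rankOnePivotLaw`). [conjecture of the cell (conjb-1 g0), refuted; no citation exists] -/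
def RankOnePivotLaw : Prop := ∀ m K : ℕ, PivotRootLawAt m K 1 (2 * m)

/-- **R1₂ — the `m = 2` cap**: a `2 × 2` pivot pencil of index `1` with `K` PSD letters has `Z₊ ≤ 2K + 2`.
STATUS: PROVED by conjb-1 g0 for EVERY index (the coefficient of `Xⁿ` in `det F` is negative only for
`n ∈ {2e} ∪ {e + d k}`, all others being sums of mixed discriminants of PSD pairs, so `det F` has `≤ 2(K+1)` sign
variations; Mathlib's Descartes rule; companion file `…CensusPivotTwoDescartes.lean`).  Lower side: `2K − 3` is
attained for `K = 4, 5, 6` (`RankOneStaircase`). [statement of the cell (conjb-1 g0/g1); no citation exists] -/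
def RankOnePivotLawTwo : Prop := ∀ K : ℕ, PivotRootLawAt 2 K 1 (2 * K + 2)

/-- **Softmax staircase** (lower-bound family): at `m = 2`, index `1`, `K` PSD letters allow at least `2K − 3` positive
roots for every `K ≥ 4`, i.e. the row with budget `2K − 4` FAILS.  STATUS: OPEN as a family; the members `K = 4, 5, 6`
are certified exactly (5, 7, 9 positive roots; exponents `{0,4,5,6,16}`, `{0,3,4,5,11,67}`, `{0,3,4,5,11,67,515}`;
companion files `…CensusPivotRankOne.lean`, `…CensusPivotStaircase.lean`).  (`2 * K - 4` is natural subtraction; the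
guard `4 ≤ K` makes it the printed value.) [conjecture of the cell (conjb-1 g0, `ConjB1SketchR2.lean`); no citation exists] -/
def RankOneStaircase : Prop := ∀ K : ℕ, 4 ≤ K → ¬ PivotRootLawAt 2 K 1 (2 * K - 4)

/-- **R1″ — explicit linear-in-`K` index-1 rung** (conjb-1 g2): pivot index `1 ⇒ Z₊ ≤ 2m(K+1)`.  In resolvent language
(`det F = D − x^e N`, `ψ = log D − log N`): `ψ` has at most `m(K+1) − 1` dents at every slope.  Consistent with every
index-1 object of record (staircases `2K − 3` at `m = 2`; time-multiplexed staircases `(K−1)m − 1`).  STATUS: OPEN.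
[conjecture of the cell (conjb-1 g2, `ConjB1SketchR3.lean`); no citation exists] -/
def RankOnePivotLawLinK : Prop := ∀ m K : ℕ, PivotRootLawAt m K 1 (2 * m * (K + 1))

/-- **R1‴ — the bilinear explicit rank-one pivot law** (conjb-1 g2, from the DENT CENSUS `g2/num/dents.py`: on every
certified index-1 object `#dents(ψ) = (roots − 1)/2`, conjecturally `#dents ≤ (m−1)(K−1)`): pivot index
`1 ⇒ Z₊ ≤ 2(m−1)(K−1) + 2`.  Tight at `(1,K)`, `(m,1)`, `(2,2)`; strictly below the proved `m = 2` cap `2K + 2`;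
≈ 2× above the multiplexed staircases.  Cheapest falsifier: a `(2,K)` index-1 pencil with `2K + 1` positive roots, or a
three-channel `(3,4)` design with `> 14`.  STATUS: OPEN (ONE-SEAT numerical pattern on five objects).  (`m − 1`, `K − 1`
are natural subtractions: at `m = 0` or `K = 0` the budget is `2`, harmless since `Z₊ ≤ 1` there.)
[conjecture of the cell (conjb-1 g2, `ConjB1SketchR3.lean`); no citation exists] -/
def RankOnePivotLawBilinear : Prop := ∀ m K : ℕ, PivotRootLawAt m K 1 (2 * (m - 1) * (K - 1) + 2)

/-- **R1‴b — the safe bilinear form** `Z₊ ≤ 2(m−1)K + 2` at pivot index `1` (the dent heuristic with the pivot's own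
PSD part `J + W Wᵀ` counted as a `(K+1)`-st letter).  At `m = 2` it EQUALS the proved cap `2K + 2`; a `(2,3)` pivot
pencil with `7` positive roots would separate R1‴ (dead) from R1‴b (alive) — black-box search found at most `4`
(conjb-1 g2 `g2/num/falsify_m2k3.py`).  STATUS: OPEN. [conjecture of the cell (conjb-1 g2); no citation exists] -/
def RankOnePivotLawBilinearWeak : Prop := ∀ m K : ℕ, PivotRootLawAt m K 1 (2 * (m - 1) * K + 2)

/-- **Diagonal-channel rung** (conjb-1 g2): all PSD letters DIAGONAL, pivot index `1` ⇒ `Z₊ ≤ m²(K+1) + 2` (the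
«handover + kink» count of the memo §3A predicts `Z₊ ≲ m²K`; the time-multiplexed staircases give `≳ (2/3)·m·K`).
First provable family rung of the dent law.  STATUS: OPEN. [conjecture of the cell (conjb-1 g2); no citation exists] -/
def DiagonalRankOneLaw : Prop :=
  ∀ (m K e : ℕ) (d : Fin K → ℕ) (J : Matrix (Fin m) (Fin m) ℝ) (P : Fin K → Matrix (Fin m) (Fin m) ℝ),
    J.IsSymm → (∀ k, (P k).PosSemidef) → (∀ k i j, i ≠ j → P k i j = 0) →
    (∃ W : Matrix (Fin m) (Fin 1) ℝ, (J + W * Wᵀ).PosSemidef) →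
    pivotPosRoots e d J P ≤ m * m * (K + 1) + 2

/-- **Resolvent–Descartes bound at index 1** (conjb-1 g1's claim: matrix-determinant lemma
`det F = D − x^e N` with `D = det A`, `N = wᵀ adj(A) w` posynomials in the letters' exponents, Cauchy–Binet positivity
of their coefficients, Mathlib's rule of signs): `Z₊ ≤ 2·C(K+m−1, m−1)`.  STATUS: **PROVED** in the kernel —
`Pivot.rankOneResolventDescartes_holds : RankOneResolventDescartes` (val-sym-mdr-p2 g3, p447079,
`Theorems/LacunarySymmetroidMatrixDescartesCensusPivotResolventDescartes.lean`; route: `F` is a signed Gram pencil of the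
columns of `√(J + W Wᵀ)`, `√P_k` and `W` — `Pivot.GramExpansion.det_gramPencil`, p446783, via the tree's Cauchy–Binet
`Literature.Analysis.TotalPositivity.det_mul_eq_sum_strictMono` — with negative coefficients only through the `W` column,
at `≤ C(K+m−1, m−1)` exponents, whence `Pivot.TwoDescartes.card_posRoots_le_two_mul_card`; desk words R1484 (a): a
Descartes-scale bound for THIN formats, better than the trivial `C(m+K, m) − 1` exactly when `K > m`; nothing at fat
formats).  Its `m = 2` instance `2(K+1)` is `RankOnePivotLawTwo` (proved earlier).  (`m − 1` natural subtraction; at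
`m = 0` the budget is `2·C(K−1,0) = 2`, harmless.)  This `def` is unchanged by the annotation (2026-08-27).
[statement of the cell (conjb-1 g1, `ConjB1SketchR2.lean`); no citation exists] -/
def RankOneResolventDescartes : Prop :=
  ∀ m K : ℕ, PivotRootLawAt m K 1 (2 * Nat.choose (K + m - 1) (m - 1))

/-- **R1⁻ — law-level index-1 slice, linear in `m` with a `2^{CK}` factor**: `∃ C, ∀ m K, Z₊ ≤ 2^{CK}·m` at pivot
index `1`.  Survives every object of record (the staircases are linear in `K`).  STATUS: OPEN.
[conjecture of the cell (conjb-1 g0); no citation exists] -/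
def RankOnePivotLawLin : Prop := ∃ C : ℕ, ∀ m K : ℕ, PivotRootLawAt m K 1 (2 ^ (C * K) * m)

/-- **R1′ — polynomial rank-one law** (conjb-1 g1's replacement of R1 as first killable family rung):
`∃ C, ∀ m K`, pivot index `1 ⇒ Z₊ ≤ (m(K+1))^C`.  Cheapest kill: an index-1 family with `m ≍ K` and `Z₊` exponential
in `K` (the resolvent–Descartes bound allows `2·C(2K−1,K−1) ≍ 4^K` there).  STATUS: OPEN.
[conjecture of the cell (conjb-1 g1, `ConjB1SketchR2.lean`); no citation exists] -/
def RankOnePivotLawPoly : Prop := ∃ C : ℕ, ∀ m K : ℕ, PivotRootLawAt m K 1 ((m * (K + 1)) ^ C)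

/-- **PIL — pivot-index law, `K`-free form** (conjb-1 g0): `∃ C, ∀ m K q, Z₊ ≤ 2m·(q+1)^{C·log₂(m+1)}` (`log₂` as
`Nat.log 2`).  Via the cell's lift `(m,K) ↦ (m(K+1), 2K)`, `q ≤ m`, it would give the quasi-polynomial shape B⁺
(bookkeeping in conjb-1's NOTES §1, not formalised).  Its `q = 1`, `C`-free instance R1 is refuted, so PIL can only
hold with the `log` factor doing real work.  STATUS: OPEN. [conjecture of the cell (conjb-1 g0); no citation exists] -/
def PivotIndexLaw : Prop :=
  ∃ C : ℕ, ∀ m K q : ℕ, PivotRootLawAt m K q (2 * m * (q + 1) ^ (C * Nat.log 2 (m + 1)))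

/-- **PIL_K — pivot-index law with a `2^{CK}` factor** (conjb-1 g0): `∃ C, ∀ m K q,
Z₊ ≤ 2^{CK}·m·(q+1)^{C·log₂(m+1)}` (⇒ `KPlusLogSqLaw` via the lift, bookkeeping not formalised).  STATUS: OPEN.
[conjecture of the cell (conjb-1 g0); no citation exists] -/
def PivotIndexLawK : Prop :=
  ∃ C : ℕ, ∀ m K q : ℕ, PivotRootLawAt m K q (2 ^ (C * K) * m * (q + 1) ^ (C * Nat.log 2 (m + 1)))

/-- **PIL′ = C1′ — pivot-index law, polynomial in `(m, K)` at bounded index, quasi-polynomial only through the index**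
(conjb-1 g1): `∃ C, ∀ m K q, Z₊ ≤ (m(K+1))^C · (q+1)^{C·log₂(m+1)}`.  Via the lift it implies the B⁺ shape and hence
`KPlusLogSqLaw` (bookkeeping in conjb-1's NOTES §1/§9, not formalised).  STATUS: OPEN; the top of the column.
[conjecture of the cell (conjb-1 g1, `ConjB1SketchR2.lean`); no citation exists] -/
def PivotIndexLawPoly : Prop :=
  ∃ C : ℕ, ∀ m K q : ℕ, PivotRootLawAt m K q ((m * (K + 1)) ^ C * (q + 1) ^ (C * Nat.log 2 (m + 1)))

/-! ## Bookkeeping: the explicit index-1 rungs nest -/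

/-- R1‴ ⇒ R1‴b pointwise in `(m, K)`. [bookkeeping (conjb-1 g2)] -/
theorem rankOnePivotLawBilinearWeak_of_bilinear (h : RankOnePivotLawBilinear) : RankOnePivotLawBilinearWeak := by
  intro m K
  refine pivotRootLawAt_mono (h m K) ?_
  have h1 : K - 1 ≤ K := Nat.sub_le K 1
  have h2 := Nat.mul_le_mul_left (2 * (m - 1)) h1
  omega

/-- R1‴ ⇒ R1″ pointwise in `(m, K)` for `m ≥ 1`. [bookkeeping (conjb-1 g2)] -/
theorem rankOnePivotLawLinK_of_bilinear (h : RankOnePivotLawBilinear) (m K : ℕ) (hm : 0 < m) :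
    PivotRootLawAt m K 1 (2 * m * (K + 1)) := by
  refine pivotRootLawAt_mono (h m K) ?_
  obtain ⟨m, rfl⟩ := Nat.exists_eq_succ_of_ne_zero hm.ne'
  rcases K with _ | K
  · simp
  · simp only [Nat.succ_sub_one]
    nlinarith [Nat.zero_le m, Nat.zero_le K]

/-- R1″ at `m = 2` is the proved cap up to slack: `RankOnePivotLawTwo → PivotRootLawAt 2 K 1 (2·2·(K+1))`. [bookkeeping] -/
theorem rankOnePivotLawLinK_two_of_two (h : RankOnePivotLawTwo) (K : ℕ) : PivotRootLawAt 2 K 1 (2 * 2 * (K + 1)) :=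
  pivotRootLawAt_mono (h K) (by omega)

end Summit.ValiantsHypothesis.ValiantsHypothesis.Theorems.LacunarySymmetroidMatrixDescartes.Pivot
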